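import Mathlib
import HarnessLib
import Summits.NavierStokesRegularity.NavierStokesRegularity.Theses.TypeIIInviscidRelaxation
import Literature.Analysis.FluidPDE.TypeIICoreWitness

set_option linter.dupNamespace false

/-!
# Line `columnar_comparison_flow` for crux `ColumnarCoreExclusion` (stmt-NavierStokesRegularity-1966)

LINE-FIRST SKELETON (linewriter-ns-typeiiinviscid-1, g1 — second variant; g0 registered
`anchored_late_columnar_core`: anchor [L] + monolithic local horizon [XL]).  The crux (rank 5 of route
`TypeIIInviscidRelaxation`): a non-Type-I blow-up whose velocity-maximum core is, at every level `K` and frequently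
before `T`, `K⁻¹`-close on `K` core radii to a COLUMNAR profile (`TypeIICoreWitness IsColumnar ν K u t`) is
impossible.

ARCHITECTURE (comparison flow = the 2½-dimensional road, three research stubs, kernel-checked composition).  The
monolithic horizon stub of g0 ("a late columnar witness ⇒ `u` bounded on `[t,T) × B(x₀, KL/2)`") hides two different
tasks; this line separates them and names the print theorem that carries the first:

* `stub_anchoredLateColumnarWitness` [research · L] — SHARED with g0 (same name, same signature): a point `xs` singular
  at `T` covered at every level `K` by a LATE (`(T-t)V ≤ KL`) witness ANCHORED at `xs` (`dist xs x₀ ≤ KL/4`).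
* `stub_columnarComparisonFlow` [research · M, print-backed] — CONSTRUCTION.  From a level-`K ≥ 1` columnar witness at
  time `t` build an EXACTLY columnar (invariant under translations along the witness axis `Q e_z`) classical
  Navier–Stokes solution `v` on `[t, T]`, bounded, with `‖u(t) - v(t)‖ ≤ A·V/K` on the half core ball `B(x₀, KL/2)`
  (`A` universal).  Mechanism: average `u(t)` along the axis over the window `|τ| ≤ KL/2` (this is `2V/K`-close to
  `u(t)` on the half ball because `u(t)` is `V/K`-close to the `z`-independent `V·QW`), correct the `O(V/(K²L))`
  horizontal divergence and extend the stream function outside the disc; the columnar datum launches a global smooth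
  2½D flow (2D Navier–Stokes for the horizontal part — Ladyzhenskaya; Giga–Matsui–Sawada 2001 for merely bounded data —
  plus an advected–diffused vertical component, maximum principle).  Why it might fail: only bookkeeping (the
  divergence correction and the exterior extension must stay `O(V/K)` in `C⁰`); sizes of `∇v` are NOT claimed.
* `stub_columnarShadowing` [research · XL → the honest residue] — STABILITY of the blow-up solution `u` around the
  columnar flow `v` on the finite horizon `[t, T)`, `(T-t)V ≤ KL` (at most `K` core turnovers), locally on
  `B(x₀, 3KL/8)`, from `C⁰`-closeness `A·V/K` at time `t` and core Reynolds number `LV/ν ≥ K`, for `K ≥ K₀(A)`.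
  Print anchors: 3D flows close to 2D flows are global (Iftimie 1999, Gallagher 1997, Chemin–Gallagher 2010 slowly
  varying in one direction) — all need smallness RELATIVE TO `ν` in scale-invariant norms, which `C⁰`-closeness `V/K`
  at Reynolds `≥ K` does not give; fluid outside the ball can reach `B(x₀, 3KL/8)` within the horizon (speed `≤ V`,
  time `≤ KL/V`), and pressure is non-local.  This stub is where the crux is genuinely open.
* `ColumnarCoreExclusion_of` — PROVED composition: `A` from the construction, `K₀(A)` from the stability stub, a
  late level-`K₀` witness anchored at the singular point `xs`, the comparison flow, the local bound on
  `[t,T) × B(x₀, 3K₀L/8)` ⊇ `(T-ρ², T) × B_ρ(xs)` with `ρ = min (K₀L/8) √(T-t)` — contradiction.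

No new definitions; stubs over `TypeIICoreWitness`, `IsColumnar`, `eZ`, `IsClassicalNSSolutionOn`,
`IsMaximalSmoothSolution`, `IsLerayHopfOn`, `HasRapidSpatialDecay`, `IsTypeIBlowup`.  Navier–Stokes regularity is
NOT proved by anything here.  decomp-ns line-writer g1.
-/

namespace Summit.NavierStokesRegularity.NavierStokesRegularity.Cruxes.ColumnarCoreExclusion.ColumnarComparisonFlow

open Literature.Analysis.FluidPDE Set Metric

/-- [research · L; SHARED with line `anchored_late_columnar_core`] **Anchored late columnar witnesses.** Under the
hypotheses of the crux `ColumnarCoreExclusion` (maximal smooth Leray–Hopf solution from rapidly decaying data, not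
Type I, columnar core witnesses at every level frequently before `T`), there is a point `xs`, SINGULAR at time `T`
(unbounded on every backward parabolic neighbourhood), such that for every level `K > 0` some level-`K` columnar
witness `(t, x₀, L, V, Q, W)`, `0 < t < T`, is LATE — `(T - t)·V ≤ K·L` — and ANCHORED at `xs` —
`dist xs x₀ ≤ K·L/4`. -/
theorem stub_anchoredLateColumnarWitness {ν T : ℝ}
    {u : ℝ → EuclideanSpace ℝ (Fin 3) → EuclideanSpace ℝ (Fin 3)}
    {p : ℝ → EuclideanSpace ℝ (Fin 3) → ℝ}
    (hν : 0 < ν) (hT : 0 < T) (hmax : IsMaximalSmoothSolution ν 0 u p T)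
    (hLH : IsLerayHopfOn T ν 0 (u 0) u) (hdec : HasRapidSpatialDecay (u 0))
    (hnI : ¬ IsTypeIBlowup u T)
    (hw : ∀ K : ℝ, 0 < K → ∀ t₀ < T, ∃ t, t₀ < t ∧ t < T ∧ TypeIICoreWitness IsColumnar ν K u t) :
    ∃ xs : EuclideanSpace ℝ (Fin 3),
      (¬ ∃ ρ M : ℝ, 0 < ρ ∧ ∀ s ∈ Ioo (T - ρ ^ 2) T, ∀ x ∈ ball xs ρ, ‖u s x‖ ≤ M) ∧
      ∀ K : ℝ, 0 < K → ∃ t : ℝ, 0 < t ∧ t < T ∧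
        ∃ (x₀ : EuclideanSpace ℝ (Fin 3)) (L V : ℝ)
          (Q : EuclideanSpace ℝ (Fin 3) ≃ₗᵢ[ℝ] EuclideanSpace ℝ (Fin 3))
          (W : EuclideanSpace ℝ (Fin 3) → EuclideanSpace ℝ (Fin 3)),
          0 < L ∧ 0 < V ∧ IsColumnar W ∧ (∀ x, ‖u t x‖ ≤ V) ∧
          (∃ x₁, dist x₁ x₀ ≤ L ∧ V ≤ 2 * ‖u t x₁‖) ∧
          (∃ y y' : EuclideanSpace ℝ (Fin 3), ‖y‖ ≤ 1 ∧ ‖y'‖ ≤ 1 ∧ (4 : ℝ)⁻¹ ≤ ‖W y - W y'‖) ∧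
          K * ν ≤ L * V ∧
          (∀ y : EuclideanSpace ℝ (Fin 3), ‖y‖ ≤ K →
            ‖V⁻¹ • Q.symm (u t (x₀ + L • Q y)) - W y‖ ≤ K⁻¹) ∧
          (T - t) * V ≤ K * L ∧ dist xs x₀ ≤ K * L / 4 := by
  sorry

/-- [research · M, print-backed: 2D Navier–Stokes global regularity (Ladyzhenskaya 1959; Giga–Matsui–Sawada 2001 for
bounded data) + the maximum principle for the vertical component of a 2½D flow] **Columnar comparison flow.**  There
is a universal `A > 0` such that: whenever a classical solution `u` on `[0,T)` (Leray–Hopf, rapidly decaying datum)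
carries at a time `0 < t < T` a level-`K ≥ 1` columnar core datum — sup `‖u(t)‖ ≤ V`, core Reynolds number
`LV/ν ≥ K`, and `V⁻¹Q⁻¹u(t)(x₀ + LQ·)` is `K⁻¹`-close on `‖y‖ ≤ K` to a profile `W` invariant under vertical
translations — there is an EXACTLY COLUMNAR classical Navier–Stokes solution `v` (pressure `q`) on `[t, T]`,
invariant under translations along the witness axis `Q e_z`, bounded on `[t,T] × ℝ³`, with
`‖u(t,x) - v(t,x)‖ ≤ A·V/K` on the half core ball `B(x₀, KL/2)`.  (Axial average of `u(t)` over `|τ| ≤ KL/2`,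
divergence correction `O(V/K)`, exterior extension of the stream function, global 2½D flow.) -/
theorem stub_columnarComparisonFlow :
    ∃ A : ℝ, 0 < A ∧
      ∀ (ν T t K : ℝ) (u : ℝ → EuclideanSpace ℝ (Fin 3) → EuclideanSpace ℝ (Fin 3))
        (p : ℝ → EuclideanSpace ℝ (Fin 3) → ℝ),
        0 < ν → 0 < T → IsClassicalNSSolutionOn (Ico 0 T) ν 0 u p → IsLerayHopfOn T ν 0 (u 0) u →
        HasRapidSpatialDecay (u 0) → 0 < t → t < T → 1 ≤ K →
        ∀ (x₀ : EuclideanSpace ℝ (Fin 3)) (L V : ℝ)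
          (Q : EuclideanSpace ℝ (Fin 3) ≃ₗᵢ[ℝ] EuclideanSpace ℝ (Fin 3))
          (W : EuclideanSpace ℝ (Fin 3) → EuclideanSpace ℝ (Fin 3)),
          0 < L → 0 < V → IsColumnar W → (∀ x, ‖u t x‖ ≤ V) → K * ν ≤ L * V →
          (∀ y : EuclideanSpace ℝ (Fin 3), ‖y‖ ≤ K →
            ‖V⁻¹ • Q.symm (u t (x₀ + L • Q y)) - W y‖ ≤ K⁻¹) →
          ∃ (v : ℝ → EuclideanSpace ℝ (Fin 3) → EuclideanSpace ℝ (Fin 3))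
            (q : ℝ → EuclideanSpace ℝ (Fin 3) → ℝ) (Mv : ℝ),
            IsClassicalNSSolutionOn (Icc t T) ν 0 v q ∧
            (∀ s ∈ Icc t T, ∀ (x : EuclideanSpace ℝ (Fin 3)) (τ : ℝ), v s (x + τ • Q eZ) = v s x) ∧
            (∀ s ∈ Icc t T, ∀ x, ‖v s x‖ ≤ Mv) ∧
            (∀ x ∈ ball x₀ (K * L / 2), ‖u t x - v t x‖ ≤ A * V / K) := by
  sorry

/-- [research · XL — the honest residue of the crux; print anchors Iftimie 1999, Gallagher 1997, Chemin–Gallagher 2010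
(3D flows close to 2D flows), Ponce–Racke–Sideris–Titi 1994 (stability of large global solutions)]
**Finite-horizon local shadowing of a columnar flow by the blow-up solution.**  For every `A > 0` there is a level
`K₀ ≥ 1` such that for `K ≥ K₀`: if a classical solution `u` on `[0,T)` (Leray–Hopf, rapidly decaying datum) has at
time `0 < t < T` the core normalisation (sup `‖u(t)‖ ≤ V`, a near-maximum within `L` of `x₀`, core Reynolds number
`LV/ν ≥ K`), the horizon is at most `K` core turnovers (`(T-t)V ≤ KL`), and an exactly columnar bounded classical
solution `v` on `[t,T]` (axis direction `Q e_z`) is `A·V/K`-close to `u(t)` on `B(x₀, KL/2)`, then `u` is bounded on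
`[t,T) × B(x₀, 3KL/8)`.  Why it might fail: `C⁰`-closeness `V/K` at Reynolds `≥ K` is far from the `ν`-relative
smallness the 2D-perturbation theorems need (Gronwall over `K` turnovers costs `e^{CK·Re}`); exterior fluid reaches the
inner ball within the horizon; pressure is non-local. -/
theorem stub_columnarShadowing :
    ∀ A : ℝ, 0 < A → ∃ K₀ : ℝ, 1 ≤ K₀ ∧ ∀ K : ℝ, K₀ ≤ K →
      ∀ (ν T t : ℝ) (u : ℝ → EuclideanSpace ℝ (Fin 3) → EuclideanSpace ℝ (Fin 3))
        (p : ℝ → EuclideanSpace ℝ (Fin 3) → ℝ),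
        0 < ν → 0 < T → IsClassicalNSSolutionOn (Ico 0 T) ν 0 u p → IsLerayHopfOn T ν 0 (u 0) u →
        HasRapidSpatialDecay (u 0) → 0 < t → t < T →
        ∀ (x₀ : EuclideanSpace ℝ (Fin 3)) (L V : ℝ)
          (Q : EuclideanSpace ℝ (Fin 3) ≃ₗᵢ[ℝ] EuclideanSpace ℝ (Fin 3)),
          0 < L → 0 < V → (∀ x, ‖u t x‖ ≤ V) →
          (∃ x₁, dist x₁ x₀ ≤ L ∧ V ≤ 2 * ‖u t x₁‖) → K * ν ≤ L * V → (T - t) * V ≤ K * L →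
          ∀ (v : ℝ → EuclideanSpace ℝ (Fin 3) → EuclideanSpace ℝ (Fin 3))
            (q : ℝ → EuclideanSpace ℝ (Fin 3) → ℝ) (Mv : ℝ),
            IsClassicalNSSolutionOn (Icc t T) ν 0 v q →
            (∀ s ∈ Icc t T, ∀ (x : EuclideanSpace ℝ (Fin 3)) (τ : ℝ), v s (x + τ • Q eZ) = v s x) →
            (∀ s ∈ Icc t T, ∀ x, ‖v s x‖ ≤ Mv) →
            (∀ x ∈ ball x₀ (K * L / 2), ‖u t x - v t x‖ ≤ A * V / K) →
            ∃ M : ℝ, ∀ s ∈ Ico t T, ∀ x ∈ ball x₀ (3 * K * L / 8), ‖u s x‖ ≤ M := by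
  sorry

/-- **Composition (kernel-checked, no sorry outside the stubs):** the three stubs imply the crux
`ColumnarCoreExclusion` BY NAME.  `A` from the construction stub, `K₀(A)` from the shadowing stub, a late
level-`K₀` columnar witness anchored at the singular point `xs`, the comparison flow `v`, and the bound on
`[t, T) × B(x₀, 3K₀L/8)`, which contains `(T - ρ², T) × B_ρ(xs)` for `ρ = min (K₀L/8) √(T - t)` — contradicting
the singularity of `xs`. -/
theorem ColumnarCoreExclusion_of :
    Summit.NavierStokesRegularity.NavierStokesRegularity.Theses.TypeIIInviscidRelaxation.ColumnarCoreExclusion := by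
  intro ν T hν hT u p hmax hLH hdec hnI hw
  obtain ⟨A, hA, hcomp⟩ := stub_columnarComparisonFlow
  obtain ⟨K₀, hK₀1, hstab⟩ := stub_columnarShadowing A hA
  have hK₀ : 0 < K₀ := lt_of_lt_of_le one_pos hK₀1
  obtain ⟨xs, hsing, hcov⟩ := stub_anchoredLateColumnarWitness hν hT hmax hLH hdec hnI hw
  obtain ⟨t, ht0, htT, x₀, L, V, Q, W, hL, hV, hcol, hbd, hnear, hosc, hRe, hclose, hlate, hdist⟩ :=
    hcov K₀ hK₀
  obtain ⟨v, q, Mv, hv, hvcol, hvbd, hvclose⟩ :=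
    hcomp ν T t K₀ u p hν hT hmax.1 hLH hdec ht0 htT hK₀1 x₀ L V Q W hL hV hcol hbd hRe hclose
  obtain ⟨M, hM⟩ := hstab K₀ le_rfl ν T t u p hν hT hmax.1 hLH hdec ht0 htT x₀ L V Q hL hV hbd hnear
    hRe hlate v q Mv hv hvcol hvbd hvclose
  apply hsing
  have hTt : 0 < T - t := sub_pos.2 htT
  set ρ : ℝ := min (K₀ * L / 8) (Real.sqrt (T - t)) with hρ
  have hρpos : 0 < ρ := lt_min (by positivity) (Real.sqrt_pos.2 hTt)
  have hρsq : ρ ^ 2 ≤ T - t :=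
    calc ρ ^ 2 ≤ (Real.sqrt (T - t)) ^ 2 := pow_le_pow_left₀ hρpos.le (min_le_right _ _) 2
      _ = T - t := Real.sq_sqrt hTt.le
  have hρle : ρ ≤ K₀ * L / 8 := min_le_left _ _
  refine ⟨ρ, M, hρpos, fun s hs x hx => hM s ⟨?_, hs.2⟩ x ?_⟩
  · linarith [hs.1]
  · rw [mem_ball] at hx ⊢
    calc dist x x₀ ≤ dist x xs + dist xs x₀ := dist_triangle _ _ _
      _ < ρ + K₀ * L / 4 := by linarith
      _ ≤ K₀ * L / 8 + K₀ * L / 4 := by linarith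
      _ = 3 * K₀ * L / 8 := by ring

end Summit.NavierStokesRegularity.NavierStokesRegularity.Cruxes.ColumnarCoreExclusion.ColumnarComparisonFlow
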